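import Summits.QuantumFields.YangMills.Theorems.FlatTubeReductionAssembly
import Summits.QuantumFields.YangMills.Theorems.FemtoCutoffLadderSubOctaveBoundedReshape
import HarnessLib

/-!
# Route `FlatTubeReduction` — the `UpStepEv` architecture certificate (shared incommensurable step with `FemtoCutoffLadder`)

Seat ym-line-fcl-p3 g5 (2026-08-28).  R2b1 is a RECORD rung (`FemtoGapOfRecord`) — not infinite volume, not the Clay gap, no summit; every
theorem here is an implication from OPEN route items.

Route `FlatTubeReduction` (rev 2) still closes through the shared item `SubOctaveBounded` (stmt-QuantumFields-24085, its rank 5; the STABILITY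
direction, threshold before the level), while route `FemtoCutoffLadder` switched at rev 24 to the VARIATIONAL eventually-form step `UpStepEv`
(stmt-QuantumFields-26796; engine `PinnedUpStep` stmt-QuantumFields-26925; `Assembly3` closed).  This file certifies the same switch for
`FlatTubeReduction`, so that 24085 can leave BOTH cones:

* The tower certificate `FemtoCutoffLadder.femtoGapOfRecord_of_octave_upStep_fixedLattice` (seat g3, landed) — `OctaveStepDecay → (UpStepEv body)
  → FemtoGapFixedLattice → FemtoGapOfRecord` — applies to THIS route's `OctaveStepDecay` verbatim (definitionally the same Prop).
* ★★ `femtoGapOfRecord_of_nearFlatRatioLaw_octave_upStep : NearFlatRatioLaw → OctaveStepDecay → (UpStepEv body) → FemtoGapOfRecord` — the route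
  after K2 (`offTubeSuppression_proof`) with the incommensurable leg replaced; and BY NAME with FemtoCutoffLadder's decl,
  ★★ `femtoGapOfRecord_of_nearFlatRatioLaw_octave_upStepEv : NearFlatRatioLaw → OctaveStepDecay → Theses.FemtoCutoffLadder.UpStepEv → FemtoGapOfRecord`.
  A planner re-lining FlatTubeReduction to `{NearFlatRatioLaw, OffTubeSuppression (proved), OctaveStepDecay, UpStepEv}` closes its new assembly by
  `exact femtoGapOfRecord_of_nearFlatRatioLaw_octave_upStep h₁ h₃ hU`.
-/

set_option autoImplicit false

namespace Summit.QuantumFields.YangMills.Theorems.FlatTubeReduction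

open Summit.QuantumFields.YangMills.Theses.FlatTubeReduction
open Summit.QuantumFields.YangMills.Theorems.FemtoTransferGap

/-- ★★ **Route FlatTubeReduction in the `UpStepEv` architecture**: `NearFlatRatioLaw → OctaveStepDecay → (UpStepEv body) → FemtoGapOfRecord`
(K2 `OffTubeSuppression` is the theorem `offTubeSuppression_proof`; the fixed-lattice leaf from K1 by `femtoGapFixedLattice_of_nearFlatRatioLaw`).
The incommensurable leg is the VARIATIONAL eventually-form step shared with FemtoCutoffLadder (stmt-QuantumFields-26796) instead of
`SubOctaveBounded` (stmt-QuantumFields-24085). [cite: LuscherWeiszWolff1991] [cite: Luscher1983, §3] -/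
theorem femtoGapOfRecord_of_nearFlatRatioLaw_octave_upStep (h₁ : NearFlatRatioLaw) (h₃ : OctaveStepDecay)
    (hU : ∃ C lam0 : ℝ, 0 < lam0 ∧ ∀ lam : ℝ, 0 < lam → lam ≤ lam0 → ∃ L0 : ℕ,
      ∀ (L' : ℕ) [NeZero L'] (L : ℕ) [NeZero L], L0 ≤ L' → L' < L → L < 2 * L' →
        ∀ β β' : ℝ, InFemtoWindow lam β L → InFemtoWindow lam β' L' → luscherLambda β L = luscherLambda β' L' →
          secondValue su2Rep L' β' ^ L' * topValue su2Rep L β ^ L ≤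
            Real.exp (C * luscherLambda β L ^ 2) * (secondValue su2Rep L β ^ L * topValue su2Rep L' β' ^ L')) :
    FemtoGapOfRecord :=
  -- this route's `OctaveStepDecay` is FemtoCutoffLadder's verbatim (definitionally equal Props)
  Summit.QuantumFields.YangMills.Theorems.FemtoCutoffLadder.femtoGapOfRecord_of_octave_upStep_fixedLattice (by exact h₃) hU
    (femtoGapFixedLattice_of_nearFlatRatioLaw h₁)

/-- ★★ **By name with FemtoCutoffLadder's item**: `NearFlatRatioLaw → OctaveStepDecay → Theses.FemtoCutoffLadder.UpStepEv → FemtoGapOfRecord`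
(`UpStepEv` = stmt-QuantumFields-26796, whose pinned engine is `PinnedUpStep`, stmt-QuantumFields-26925). [cite: LuscherWeiszWolff1991] -/
theorem femtoGapOfRecord_of_nearFlatRatioLaw_octave_upStepEv (h₁ : NearFlatRatioLaw) (h₃ : OctaveStepDecay)
    (hU : Summit.QuantumFields.YangMills.Theses.FemtoCutoffLadder.UpStepEv) : FemtoGapOfRecord :=
  femtoGapOfRecord_of_nearFlatRatioLaw_octave_upStep h₁ h₃ hU

end Summit.QuantumFields.YangMills.Theorems.FlatTubeReduction
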